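import Literature.Geometry.Lorentzian.MultiCentreKerrSchild
import HarnessLib

/-!
# Frame (tilt) bound for clock-adapted near-isometries of pinched Lorentzian scalar products

Linear algebra behind the GLUING step of Cheeger–Gromov compactness for Lorentzian metrics. Two
overlapping `C⁰`-pinched charts (`‖Ψᵢ^* g − η‖ ≤ θ < 1`) of one spacetime have a transition map
whose differential `A` is an isometry `(E4, η + h₁) → (E4, η + h₂)`; unlike the Riemannian case this
bounds NOTHING about `‖A‖` (Lorentz boosts are non-compact — the non-uniqueness of Lorentzian
pointed limits, `PlaneWaveTilt.lean`). If however both charts are CLOCK-ADAPTED to one time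
function `t` (`t ∘ Ψᵢ = cᵢ + x⁰`, the `TameClockChartAt` clause of the tame final-state routes),
then `A` preserves the time coordinate, `(A v)⁰ = v⁰`, and this pins the frame:

**Theorem (`norm_sq_apply_le_of_clockAdapted`).** If `‖gᵢ − η‖ ≤ θ < 1` (`i = 1, 2`),
`g₂(Av, Av) = g₁(v, v)` and `(Av)⁰ = v⁰` for all `v`, then `‖A v‖² ≤ (3 + θ)/(1 − θ) · ‖v‖²`; hence
`‖A‖ ≤ √((3 + θ)/(1 − θ))` (`opNorm_le_of_clockAdapted`), and the same for `A⁻¹` by symmetry.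

Proof: `g₂(u,u) ≥ (1 − θ)‖u‖² − 2(u⁰)²` and `g₁(v,v) ≤ (1 + θ)‖v‖²` for pinched forms
(`η(u,u) = ‖u‖² − 2(u⁰)²`), and `(Av)⁰ = v⁰` with `|v⁰| ≤ ‖v‖`.

So with clock-adapted all-orders tame charts the transition maps of a uniformly tame family are
uniformly bi-Lipschitz (and then uniformly `Cᵏ`-bounded by the chain rule), which is the input under
which the classical gluing of chart limits into a limit manifold (Petersen 2006, Ch. 10, Lemma 74 ff.)
goes through leafwise-uniformly. O'Neill 1983, Ch. 5, Lemma 5.26 (perturbative signature); Petersen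
2006, Ch. 10, §3.2.

## References
* B. O'Neill, *Semi-Riemannian geometry*, Academic Press 1983, Ch. 5, Lemma 5.26. [ONeill1983]
* P. Petersen, *Riemannian Geometry*, 2nd ed., GTM 171, Springer 2006, Ch. 10, §3.2. [Petersen2006]
-/

noncomputable section

open Set Function

namespace Literature.Geometry.Lorentzian

namespace Minkowski

/-- `η(u, u) = ‖u‖² − 2(u⁰)²` on `E4 = ℝ⁴` with its Euclidean norm. [cite: ONeill1983, Ch. 3, p. 55] -/
theorem bilin_apply_self_eq_norm_sq_sub (u : E4) : bilin u u = ‖u‖ ^ 2 - 2 * u 0 ^ 2 := by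
  have h4 : ∑ i : Fin 4, u i ^ 2 = u 0 ^ 2 + ∑ i : Fin 3, u i.succ ^ 2 := Fin.sum_univ_succ _
  rw [bilin_apply, EuclideanSpace.real_norm_sq_eq, h4]
  simp only [← sq]
  ring

/-- `|u⁰| ≤ ‖u‖`, squared. [folklore] -/
theorem sq_apply_zero_le_norm_sq (u : E4) : u 0 ^ 2 ≤ ‖u‖ ^ 2 := by
  have h : |u 0| ≤ ‖u‖ := by
    have h := PiLp.norm_apply_le u 0
    rwa [Real.norm_eq_abs] at h
  nlinarith [abs_nonneg (u 0), sq_abs (u 0)]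

/-- **Pinched forms, lower bound**: `‖g − η‖ ≤ θ` gives `g(u, u) ≥ (1 − θ)‖u‖² − 2(u⁰)²`.
[cite: ONeill1983, Ch. 5, Lemma 5.26] -/
theorem sub_le_apply_self_of_norm_sub_bilin_le {g : E4 →L[ℝ] E4 →L[ℝ] ℝ} {θ : ℝ}
    (hg : ‖g - bilin‖ ≤ θ) (u : E4) : (1 - θ) * ‖u‖ ^ 2 - 2 * u 0 ^ 2 ≤ g u u := by
  have h1 : g u u = bilin u u + (g - bilin) u u := by
    simp only [sub_apply]; ring
  have h2 := (g - bilin).le_opNorm₂ u u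
  rw [Real.norm_eq_abs] at h2
  have h3 : ‖g - bilin‖ * ‖u‖ * ‖u‖ ≤ θ * ‖u‖ * ‖u‖ := by gcongr
  rw [h1, bilin_apply_self_eq_norm_sq_sub]
  nlinarith [(abs_le.mp (h2.trans h3)).1]

/-- **Pinched forms, upper bound**: `‖g − η‖ ≤ θ` gives `g(v, v) ≤ (1 + θ)‖v‖²`.
[cite: ONeill1983, Ch. 5, Lemma 5.26] -/
theorem apply_self_le_of_norm_sub_bilin_le {g : E4 →L[ℝ] E4 →L[ℝ] ℝ} {θ : ℝ}
    (hg : ‖g - bilin‖ ≤ θ) (v : E4) : g v v ≤ (1 + θ) * ‖v‖ ^ 2 := by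
  have h1 : g v v = bilin v v + (g - bilin) v v := by
    simp only [sub_apply]; ring
  have h2 := (g - bilin).le_opNorm₂ v v
  rw [Real.norm_eq_abs] at h2
  have h3 : ‖g - bilin‖ * ‖v‖ * ‖v‖ ≤ θ * ‖v‖ * ‖v‖ := by gcongr
  rw [h1, bilin_apply_self_eq_norm_sq_sub]
  nlinarith [(abs_le.mp (h2.trans h3)).2, sq_nonneg (v 0)]

end Minkowski

/-- **Frame bound for clock-adapted near-isometries** (module docstring): an isometry
`A : (E4, g₁) → (E4, g₂)` between `θ`-pinched Lorentzian scalar products, `θ < 1`, which preserves the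
time coordinate satisfies `‖A v‖² ≤ (3 + θ)/(1 − θ) · ‖v‖²`. [cite: ONeill1983, Ch. 5, Lemma 5.26] -/
theorem norm_sq_apply_le_of_clockAdapted {g₁ g₂ : E4 →L[ℝ] E4 →L[ℝ] ℝ} {θ : ℝ} (hθ : θ < 1)
    (h₁ : ‖g₁ - Minkowski.bilin‖ ≤ θ) (h₂ : ‖g₂ - Minkowski.bilin‖ ≤ θ) (A : E4 →L[ℝ] E4)
    (hiso : ∀ v, g₂ (A v) (A v) = g₁ v v) (hclock : ∀ v, A v 0 = v 0) (v : E4) :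
    ‖A v‖ ^ 2 ≤ (3 + θ) / (1 - θ) * ‖v‖ ^ 2 := by
  have hlow := Minkowski.sub_le_apply_self_of_norm_sub_bilin_le h₂ (A v)
  have hup := Minkowski.apply_self_le_of_norm_sub_bilin_le h₁ v
  have h0 := Minkowski.sq_apply_zero_le_norm_sq v
  rw [hclock v] at hlow
  rw [hiso v] at hlow
  have h1θ : 0 < 1 - θ := by linarith
  rw [div_mul_eq_mul_div, le_div_iff₀ h1θ]
  nlinarith

/-- **Operator-norm form**: `‖A‖ ≤ √((3 + θ)/(1 − θ))`. [cite: ONeill1983, Ch. 5, Lemma 5.26] -/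
theorem opNorm_le_of_clockAdapted {g₁ g₂ : E4 →L[ℝ] E4 →L[ℝ] ℝ} {θ : ℝ} (hθ : θ < 1)
    (h₁ : ‖g₁ - Minkowski.bilin‖ ≤ θ) (h₂ : ‖g₂ - Minkowski.bilin‖ ≤ θ) (A : E4 →L[ℝ] E4)
    (hiso : ∀ v, g₂ (A v) (A v) = g₁ v v) (hclock : ∀ v, A v 0 = v 0) :
    ‖A‖ ≤ Real.sqrt ((3 + θ) / (1 - θ)) := by
  refine ContinuousLinearMap.opNorm_le_bound _ (Real.sqrt_nonneg _) fun v ↦ ?_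
  have h := norm_sq_apply_le_of_clockAdapted hθ h₁ h₂ A hiso hclock v
  have hC : 0 ≤ (3 + θ) / (1 - θ) := by
    have h1θ : 0 < 1 - θ := by linarith
    have hθ' : -1 < θ := by
      have := (norm_nonneg (g₁ - Minkowski.bilin)).trans h₁
      linarith
    exact div_nonneg (by linarith) h1θ.le
  calc ‖A v‖ = Real.sqrt (‖A v‖ ^ 2) := (Real.sqrt_sq (norm_nonneg _)).symm
    _ ≤ Real.sqrt ((3 + θ) / (1 - θ) * ‖v‖ ^ 2) := Real.sqrt_le_sqrt h
    _ = Real.sqrt ((3 + θ) / (1 - θ)) * ‖v‖ := by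
        rw [Real.sqrt_mul hC, Real.sqrt_sq (norm_nonneg _)]

/-- **The inverse is bounded too** (the hypotheses are symmetric under `A ↦ A⁻¹`): for a
continuous linear EQUIVALENCE `A` as above, `‖A⁻¹‖ ≤ √((3 + θ)/(1 − θ))`; so clock-adapted pinched
transition differentials are uniformly bi-Lipschitz. [cite: ONeill1983, Ch. 5, Lemma 5.26] -/
theorem opNorm_symm_le_of_clockAdapted {g₁ g₂ : E4 →L[ℝ] E4 →L[ℝ] ℝ} {θ : ℝ} (hθ : θ < 1)
    (h₁ : ‖g₁ - Minkowski.bilin‖ ≤ θ) (h₂ : ‖g₂ - Minkowski.bilin‖ ≤ θ) (A : E4 ≃L[ℝ] E4)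
    (hiso : ∀ v, g₂ (A v) (A v) = g₁ v v) (hclock : ∀ v, A v 0 = v 0) :
    ‖(A.symm : E4 →L[ℝ] E4)‖ ≤ Real.sqrt ((3 + θ) / (1 - θ)) := by
  refine opNorm_le_of_clockAdapted hθ h₂ h₁ (A.symm : E4 →L[ℝ] E4) (fun w ↦ ?_) fun w ↦ ?_
  · have h := hiso (A.symm w)
    rw [A.apply_symm_apply] at h
    exact h.symm
  · have h := hclock (A.symm w)
    rw [A.apply_symm_apply] at h
    exact h.symm

end Literature.Geometry.Lorentzian

end
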